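/-
Copyright (c) 2026. All rights reserved.
Released under Apache 2.0 license as described in the file LICENSE.
Authors: abc-iut cell, seat abc-iut-w6-d023 (gen 3; block C / W6).
-/
import Literature.AnabelianGeometry.AbsoluteAnabelian.AbsTopIII.FrobeniusPictureMLFCompatTwistedToy
import Literature.AnabelianGeometry.AbsoluteAnabelian.AbsTopIII.FrobeniusPictureMLFShiftGlue
import HarnessLib

/-!
# [AbsTopIII] Cor. 3.6 (v), third sentence, at the twisted toy datum: the nexus self-equivalences are compatible
# with the twisted family — so even BOTH typed compatibility sentences do not force F-0360

S. Mochizuki, *Topics in Absolute Anabelian Geometry III* [MochizukiAbsTopIII2015] (kurims `paper:url-5493eb38cbb7`):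
Cor. 3.6 (v) p. 80, third sentence ("the self-equivalences in these nexus-classes are compatible with the families
of homotopies that constitute the cores and observable of (i), (iii)"), typed by abc-iut-L4-t5 as
`LogFrobeniusData.ShiftCompatStmt` (the `ℤ`-action `Φ` by translation of the first row, ONE family `K` on `𝒟`
realising the cores and `𝔖_log`, every `Φ_m` compatible with `K` in the sense of Def. 3.5 (v)); Def. 3.5 (v) p. 76.

PROOF-ONLY sequel of `FrobeniusPictureMLFCompatTwistedToy.lean` (this seat): at the twisted toy datum
(`TwistedToy.datum`: all categories `B(ℤ/2)`, all functors identities, `ι_× = ι_{log,⋎} = g` central) the twisted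
family (`TwistedToy.family`: homotopy of `([γ₁],[γ₂])` = `g ^ (#λ^{×pf} γ₂ − #λ^{×pf} γ₁)` on the glued boundary set)
is compatible with every nexus self-equivalence `Φ_m = shiftEquiv m` — boundary sets by abc-iut-w6-d023 (gen 2)'s
`glueE_shift_iff`, homotopies because the translation of the first row fixes the `λ^{×pf}`-count of a path —
assembled by gen 2's `OneMorphism.nonempty_compatibleWith_of_invariant` (`DiagramShiftInvariance`):

* `TwistedToy.compatibleWith_shiftEquiv_family`, `TwistedToy.shiftCompatStmt : datum.ShiftCompatStmt`;
* `exists_shiftCompatStmt_not_iotaOverGaloisStmt : ∃ Δ, Δ.LogObsCompatCoresStmt ∧ Δ.ShiftCompatStmt ∧ ¬ Δ.IotaOverGaloisStmt`.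

UPSHOT (with the parent file): the typed (iii) cores clause AND the typed (v) third sentence hold at a datum where
F-0360 (`IotaOverGaloisStmt`) fails; abc-iut-w6-d023 (gen 2)'s `shiftCompatStmt_of_iotaOverGaloisStmt` is thus a
sufficient-not-necessary reduction as well.  HONEST FRAMING: bookkeeping over the typed data and a toy datum
(toy ≠ model); refereed pre-IUT material; nothing here bears on [IUTchIII] Cor. 3.12 or takes a side; typed ≠ proved.
-/

namespace Literature.AnabelianGeometry.AbsoluteAnabelian

open _root_.CategoryTheory _root_.Quiver

namespace LogFrobeniusData

open DiagramOfCategories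

namespace TwistedToy

/-- `ofVal ∘ val = id` (as in the parent file). [folklore] -/
private theorem ofVal_val' (v : LFVertex) {x y : datum.diagram.obj v} (f : x ⟶ y) : ofVal v x y (val v f) = f := by
  cases v <;> rfl

/-- The underlying element of a component of the twisted homotopy (as in the parent file). [folklore] -/
private theorem val_eta_app' {a b : LFVertex} (p q : Path a b) (x : datum.diagram.obj a) :
    val b ((eta p q).app x) = Multiplicative.ofAdd (pathWt q - pathWt p) := by
  cases b <;> rfl

/-- A natural transformation between functors into a vertex category is determined, up to `HEq` along equal
functors, by the underlying elements of its components. [folklore] -/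
private theorem natTrans_heq_of_val (v : LFVertex) {C : Type} [Category C] {F G F' G' : C ⥤ datum.diagram.obj v}
    (hF : F = F') (hG : G = G') (α : F ⟶ G) (β : F' ⟶ G')
    (happ : ∀ X, val v (α.app X) = val v (β.app X)) : HEq α β := by
  subst hF hG
  rw [heq_iff_eq]
  ext X
  rw [← ofVal_val' v (α.app X), ← ofVal_val' v (β.app X), happ X]

/-- The translation of the first row fixes edge weights. [cite: MochizukiAbsTopIII2015, Corollary 3.6 (v) p.80] -/
private theorem edgeWt_shift (m : ℤ) : ∀ {a b : LFVertex} (e : a ⟶ b),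
    edgeWt ((LFVertex.shift.{0} m).map e) = edgeWt e := by
  intro a b e
  cases a <;> cases b <;> first | exact (PEmpty.elim e) | rfl

/-- The translation of the first row fixes path weights. [cite: MochizukiAbsTopIII2015, Corollary 3.6 (v) p.80] -/
private theorem pathWt_shift (m : ℤ) {a b : LFVertex} (p : Path a b) :
    pathWt ((LFVertex.shift.{0} m).mapPath p) = pathWt p := by
  induction p with
  | nil => rw [Prefunctor.mapPath_nil, pathWt, pathWt]
  | cons p e ih => rw [Prefunctor.mapPath_cons, pathWt, pathWt, ih, edgeWt_shift]

/-- The twisted homotopies of a glued pair are invariant under the translation (heterogeneously; pairs into rows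
1–2 are not glued). [cite: MochizukiAbsTopIII2015, Corollary 3.6 (v) p.80] -/
private theorem eta_shift_heq (m : ℤ) {a b : LFVertex} {p q : Path a b} (h : datum.GlueE p q) :
    HEq (eta ((LFVertex.shift.{0} m).mapPath p) ((LFVertex.shift.{0} m).mapPath q)) (eta p q) := by
  cases b with
  | row1 n => exact (datum.glueE_false_of_row_le_two (by simp [LFVertex.row]) h).elim
  | nexus => exact (datum.glueE_false_of_row_le_two (by simp [LFVertex.row]) h).elim
  | third =>
    cases a <;>
    exact natTrans_heq_of_val _
      (eq_of_heq (datum.diagram.pathFunctor_mapPath_heq (LFVertex.shift.{0} m) (datum.comapAlong_shift m) p))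
      (eq_of_heq (datum.diagram.pathFunctor_mapPath_heq (LFVertex.shift.{0} m) (datum.comapAlong_shift m) q)) _ _
      (fun X => by rw [val_eta_app', val_eta_app', pathWt_shift, pathWt_shift])
  | fourth =>
    cases a <;>
    exact natTrans_heq_of_val _
      (eq_of_heq (datum.diagram.pathFunctor_mapPath_heq (LFVertex.shift.{0} m) (datum.comapAlong_shift m) p))
      (eq_of_heq (datum.diagram.pathFunctor_mapPath_heq (LFVertex.shift.{0} m) (datum.comapAlong_shift m) q)) _ _
      (fun X => by rw [val_eta_app', val_eta_app', pathWt_shift, pathWt_shift])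
  | fifth =>
    cases a <;>
    exact natTrans_heq_of_val _
      (eq_of_heq (datum.diagram.pathFunctor_mapPath_heq (LFVertex.shift.{0} m) (datum.comapAlong_shift m) p))
      (eq_of_heq (datum.diagram.pathFunctor_mapPath_heq (LFVertex.shift.{0} m) (datum.comapAlong_shift m) q)) _ _
      (fun X => by rw [val_eta_app', val_eta_app', pathWt_shift, pathWt_shift])
  | sixth =>
    cases a <;>
    exact natTrans_heq_of_val _
      (eq_of_heq (datum.diagram.pathFunctor_mapPath_heq (LFVertex.shift.{0} m) (datum.comapAlong_shift m) p))
      (eq_of_heq (datum.diagram.pathFunctor_mapPath_heq (LFVertex.shift.{0} m) (datum.comapAlong_shift m) q)) _ _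
      (fun X => by rw [val_eta_app', val_eta_app', pathWt_shift, pathWt_shift])

/-- **Every nexus self-equivalence `Φ_m` is compatible (Def. 3.5 (v)) with the twisted family**: `Φ_Γ⃗` induces a
bijection of the glued boundary set and the twisted homotopies commute with the (identity) 2-cells.
[cite: MochizukiAbsTopIII2015, Corollary 3.6 (v) p.80] -/
theorem compatibleWith_shiftEquiv_family (m : ℤ) : Nonempty ((datum.shiftEquiv m).hom.CompatibleWith family family) :=
  OneMorphism.nonempty_compatibleWith_of_invariant (datum.shiftMor m) (datum.comapAlong_shift m)
    (datum.shiftApp_heq_id m) (datum.shiftMor_iso_app m) (fun _ _ p' => exists_shift_mapPath_eq m p')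
    family family (fun _ _ P Q => datum.glueE_shift_iff m P Q) (fun _ _ _ _ h => eta_shift_heq m h)

/-- **Cor. 3.6 (v), third sentence (`ShiftCompatStmt`) HOLDS at the twisted datum** (abc-iut-L4-t5's reductions
`realisesCoresAndLogObs_of_pull`, `shiftCompatStmt_of`). [cite: MochizukiAbsTopIII2015, Corollary 3.6 (v) p.80] -/
theorem shiftCompatStmt : datum.ShiftCompatStmt :=
  datum.shiftCompatStmt_of family
    (datum.realisesCoresAndLogObs_of_pull family isLogObservableFamily isCore4 isCore5 isCore6)
    compatibleWith_shiftEquiv_family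

end TwistedToy

/-- **Even BOTH typed compatibility sentences — the (iii) cores clause and the (v) third sentence — do not force
F-0360**: at the twisted toy datum `LogObsCompatCoresStmt` and `ShiftCompatStmt` hold while `IotaOverGaloisStmt`
fails. [cite: MochizukiAbsTopIII2015, Corollary 3.6 (v) p.80] -/
theorem exists_shiftCompatStmt_not_iotaOverGaloisStmt :
    ∃ Δ : LogFrobeniusData.{0}, Δ.LogObsCompatCoresStmt ∧ Δ.ShiftCompatStmt ∧ ¬ Δ.IotaOverGaloisStmt :=
  ⟨TwistedToy.datum, TwistedToy.logObsCompatCoresStmt, TwistedToy.shiftCompatStmt,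
    TwistedToy.not_iotaOverGaloisStmt⟩

/-- **Schema form**: "(iii) cores clause ∧ (v) third sentence ⟹ F-0360" is NOT valid over the abstract data.
[cite: MochizukiAbsTopIII2015, Corollary 3.6 (v) p.80] -/
theorem not_forall_iotaOverGaloisStmt_of_shiftCompatStmt :
    ¬ ∀ Δ : LogFrobeniusData.{0}, Δ.ShiftCompatStmt → Δ.IotaOverGaloisStmt := fun h =>
  TwistedToy.not_iotaOverGaloisStmt (h _ TwistedToy.shiftCompatStmt)

end LogFrobeniusData

end Literature.AnabelianGeometry.AbsoluteAnabelian
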